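import Mathlib.Algebra.Ring.NegOnePow
import Literature.MathematicalPhysics.QuantumLattice.InfVolFermionState
import Literature.MathematicalPhysics.QuantumLattice.HubbardModelParticleHoleProofs
import HarnessLib

/-!
# The particle–hole transformation of infinite-volume lattice fermion states

Topic `MathematicalPhysics/QuantumLattice`; seat `hubbard-downfold-unc-2` (cell `pub/hubbard-downfold`, row
«FILLING direction of BOX → WORD»: the electron-doped half of the filling axis). Companion of
`InfVolFermionStateSpinFlip` (the spin-exchange Bogoliubov automorphism and the state `ω ∘ Γ_swap`),
`InfVolFermionStateGaugeAction` (`ω ∘ γ_θ`) and `InfVolFermionStatePointGroupAction` (`ω ∘ γ`, `γ ∈ D₄`),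
and of `HubbardModelParticleHoleProofs` (Lieb's particle–hole unitary `P = particleHole ε'` of a finite
orbital set, `P c_i Pᴴ = ε'_i c†_i`). The **staggered particle–hole transformation** of the CAR algebra over
`ℤ^d × {↑,↓}` is the Bogoliubov automorphism

  `α(c_{xσ}) = ε_x c†_{xσ}`, `α(c†_{xσ}) = ε_x c_{xσ}`, `ε_x = (-1)^{x₁+⋯+x_d}`

(Lieb 1989; Tasaki §9.3.3; Essler et al. §2.2.4 — the Shiba transformation acting on both spins). On every
local algebra `𝔄_Λ` it is INNER, `α_Λ(A) = P_Λ A P_Λᴴ` (`phAut Λ = particleHoleAut (phSign Λ)`), and the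
`α_Λ` are compatible with the isotony maps `Γ(Λ ⊆ Λ')` (`fermionEmbed_incl_phAut`: both composites are the
algebra homomorphisms `c_{xσ} ↦ ε_x c†_{xσ}` — uniqueness on the CAR generators, `algHom_ext_car`); hence
precomposition defines the **particle–hole transformed state** `ω ∘ α` (`InfVolFermionState.particleHole`).

* §1 (any finite orbital set, any SIGN function `ε : ι → ℤˣ`): `particleHoleAut ε` = `Ad(P_ε)` as a
  `ℂ`-algebra homomorphism; values on `c`, `c†`, `n` (`1 - n`), compatibility with `ᴴ`; it commutes with
  the even–odd automorphism `Θ` and `particleHoleAut (-ε) = Θ ∘ particleHoleAut ε`; it is an INVOLUTION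
  (`P_ε² = (±1)·𝟙`, `particleHole_mul_particleHole`); intertwining with the second quantisation `Γ(φ)` of a
  site injection whenever the signs correspond (`fermionEmbed_comp_particleHoleAut`).
* §2 (regions of `ℤ^d`): the stagger `siteStagger x = (Σᵢ xᵢ).negOnePow` (multiplicative under translation,
  `-1` on unit steps), the local automorphisms `phAut Λ`, their values on `c_{xσ}`, `n_{xσ}`, compatibility
  with isotony, and TRANSLATION COVARIANCE UP TO PARITY:
  `Γ(τ_v) ∘ α_Λ = α_{Λ+v} ∘ Γ(τ_v)` if `ε_v = 1`, `= α_{Λ+v} ∘ Θ ∘ Γ(τ_v)` if `ε_v = -1`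
  (`fermionEmbed_shiftEmb_phAut_of_eq_one` / `_of_eq_neg_one`).
* §3 the state `ω.particleHole = ω ∘ α`: a genuine `InfVolFermionState` (all fields proved), an involution,
  even when `ω` is, `(ω ∘ α) ∘ τ_v = (ω ∘ τ_v) ∘ α` for EVEN `ω` (`IsEven.particleHole_shift`), hence
  translation invariant when `ω` is translation invariant and even; densities
  `(ω ∘ α)(n_{xσ}) = 1 - ω(n_{xσ})`, `densityAt (ω ∘ α) x = 2 - densityAt ω x` — **electron doping `n > 1`
  is hole doping `2 - n`**; mixtures.

Everything is PROVED; the definitions (`particleHoleAut`, `siteStagger`, `phSign`, `phAut`,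
`InfVolFermionState.particleHole`) have bodies; no named fact, no sorry, no instance. NOT here (next file):
the image of the Hubbard interaction (`t' ↦ -t'`, energy shift `U(1 - n)`) and the covariance of torus-limit
classes (even tori).

## References
* E. H. Lieb, *Two theorems on the Hubbard model*, Phys. Rev. Lett. 62 (1989) 1201 (the particle–hole
  unitary on a bipartite lattice, proof of Theorem 2). [cite: LiebPRL1989, proof of Theorem 2]
* H. Tasaki, *Physics and Mathematics of Quantum Many-Body Systems* (2020), §9.3.3 (particle–hole
  transformation of the Hubbard model). [cite: Tasaki2020, §9.3.3]
* F. H. L. Essler et al., *The One-Dimensional Hubbard Model* (2005), §2.2.4 eqs. (2.59)–(2.61) (Shiba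
  transformation; `n ↦ 1 - n` per spin). [cite: EsslerEtAl2005, §2.2.4 eqs. (2.59)–(2.61)]
* O. Bratteli, D. W. Robinson, *Operator Algebras and Quantum Statistical Mechanics II* (1997), §5.2.2
  Thm. 5.2.5 (Bogoliubov transformations of the CAR algebra). [cite: BratteliRobinsonII1997, §5.2.2 Thm. 5.2.5]
* H. Araki, H. Moriya, Rev. Math. Phys. 15 (2003) 93, §4.1 Def. 4.2–4.5 (`Θ`, translations, even and
  invariant states of the Fermion algebra). [cite: ArakiMoriya2003, §4.1]

## Mathlib / tree search
REUSED: `particleHole`, `particleHole_mul_conjTranspose`, `particleHole_conjTranspose_mul`,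
`particleHole_mul_annihilation_mul_conjTranspose_holds`, `particleHole_mul_creation_mul_conjTranspose`,
`particleHole_mul_numberAt_mul_conjTranspose_holds`, `particleHole_mulVec_apply`, `particleHoleWeight_mul_star`,
`norm_intCast_units` (`HubbardModelParticleHoleProofs`); `algHom_ext_car`, `parityAut(_annihilation/_creation)`,
`fermionEmbed_annihilation'`/`_creation'`, `fermionEmbed_parityAut`, `PolySite.incl/shiftEmb/pt`, `cAt`, `nAt`,
`InfVolFermionState.shift/IsEven/IsTranslationInvariant/densityAt/mix` (`InfVolFermionState`);
`Int.negOnePow` (Mathlib). `lean search 'InfVolFermionState.*particleHole'`: nothing before this file.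
-/

noncomputable section

namespace Literature.MathematicalPhysics.QuantumLattice

open Matrix Finset HubbardWave0 Literature.Probability.LatticeModels
open scoped ComplexOrder

/-! ### §1 The particle–hole automorphism of the CAR algebra of a finite orbital set (sign functions) -/

section Local

variable {ι : Type*} [LinearOrder ι] [Fintype ι]

omit [LinearOrder ι] [Fintype ι] in
/-- The phases of a sign function are unimodular. [folklore] -/
private theorem norm_signPhase (ε : ι → ℤˣ) (i : ι) : ‖(((ε i : ℤˣ) : ℤ) : ℂ)‖ = 1 := norm_intCast_units _

omit [LinearOrder ι] [Fintype ι] in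
/-- The phases of a sign function are real: `conj ε_i = ε_i`. [folklore] -/
private theorem star_signPhase (ε : ι → ℤˣ) (i : ι) : star ((((ε i : ℤˣ) : ℤ) : ℂ)) = (((ε i : ℤˣ) : ℤ) : ℂ) := by
  rw [Complex.star_def, map_intCast]

/-- **The particle–hole automorphism `α_ε(a) = P_ε a P_εᴴ`** of the CAR algebra of the finite orbital set
`ι`, for a SIGN function `ε : ι → ℤˣ` (`P_ε = particleHole ε`, unitary): the unique algebra homomorphism with
`α(c_i) = ε_i c†_i`, `α(c†_i) = ε_i c_i` (`particleHoleAut_annihilation`, `particleHoleAut_creation`; uniqueness by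
`algHom_ext_car`). [cite: Tasaki2020, §9.3.3] -/
def particleHoleAut (ε : ι → ℤˣ) : Matrix (Finset ι) (Finset ι) ℂ →ₐ[ℂ] Matrix (Finset ι) (Finset ι) ℂ where
  toFun b := particleHole (fun i => (((ε i : ℤˣ) : ℤ) : ℂ)) * b *
    (particleHole (fun i => (((ε i : ℤˣ) : ℤ) : ℂ)))ᴴ
  map_one' := by rw [Matrix.mul_one, particleHole_mul_conjTranspose _ (norm_signPhase ε)]
  map_mul' b c := by
    set P := particleHole (fun i => (((ε i : ℤˣ) : ℤ) : ℂ))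
    calc P * (b * c) * Pᴴ = P * b * (Pᴴ * P) * c * Pᴴ := by
          rw [particleHole_conjTranspose_mul _ (norm_signPhase ε), Matrix.mul_one, Matrix.mul_assoc P b c]
      _ = P * b * Pᴴ * (P * c * Pᴴ) := by simp only [Matrix.mul_assoc]
  map_zero' := by rw [Matrix.mul_zero, Matrix.zero_mul]
  map_add' b c := by rw [Matrix.mul_add, Matrix.add_mul]
  commutes' c := by
    rw [Algebra.algebraMap_eq_smul_one, Matrix.mul_smul, Matrix.mul_one, Matrix.smul_mul,
      particleHole_mul_conjTranspose _ (norm_signPhase ε)]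

/-- `α_ε(a) = P_ε a P_εᴴ` (definitional). [cite: Tasaki2020, §9.3.3] -/
theorem particleHoleAut_apply (ε : ι → ℤˣ) (b : Matrix (Finset ι) (Finset ι) ℂ) :
    particleHoleAut ε b = particleHole (fun i => (((ε i : ℤˣ) : ℤ) : ℂ)) * b *
      (particleHole (fun i => (((ε i : ℤˣ) : ℤ) : ℂ)))ᴴ :=
  rfl

/-- `α(c_i) = ε_i c†_i`. [cite: Tasaki2020, §9.3.3] -/
@[simp] theorem particleHoleAut_annihilation (ε : ι → ℤˣ) (i : ι) :
    particleHoleAut ε (annihilation i) = (((ε i : ℤˣ) : ℤ) : ℂ) • creation i :=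
  particleHole_mul_annihilation_mul_conjTranspose_holds _ (norm_signPhase ε) i

/-- `α(c†_i) = ε_i c_i` (the sign is real). [cite: Tasaki2020, §9.3.3] -/
@[simp] theorem particleHoleAut_creation (ε : ι → ℤˣ) (i : ι) :
    particleHoleAut ε (creation i) = (((ε i : ℤˣ) : ℤ) : ℂ) • annihilation i := by
  rw [particleHoleAut_apply, particleHole_mul_creation_mul_conjTranspose _ (norm_signPhase ε), star_signPhase]

/-- `α(n_i) = 1 - n_i`: **particles become holes**. [cite: EsslerEtAl2005, §2.2.4 eqs. (2.59)–(2.61)] -/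
@[simp] theorem particleHoleAut_numberAt (ε : ι → ℤˣ) (i : ι) :
    particleHoleAut ε (numberAt i) = 1 - numberAt i :=
  particleHole_mul_numberAt_mul_conjTranspose_holds _ (norm_signPhase ε) i

/-- `α` is a `*`-map: `α(bᴴ) = (α b)ᴴ`. [cite: BratteliRobinsonII1997, §5.2.2 Thm. 5.2.5] -/
theorem particleHoleAut_conjTranspose (ε : ι → ℤˣ) (b : Matrix (Finset ι) (Finset ι) ℂ) :
    particleHoleAut ε bᴴ = (particleHoleAut ε b)ᴴ := by
  rw [particleHoleAut_apply, particleHoleAut_apply, conjTranspose_mul, conjTranspose_mul,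
    conjTranspose_conjTranspose, Matrix.mul_assoc]

/-- `α(bᴴ b) = (α b)ᴴ (α b)` (positivity is preserved). [cite: BratteliRobinsonII1997, §5.2.2 Thm. 5.2.5] -/
theorem particleHoleAut_conjTranspose_mul_self (ε : ι → ℤˣ) (b : Matrix (Finset ι) (Finset ι) ℂ) :
    particleHoleAut ε (bᴴ * b) = (particleHoleAut ε b)ᴴ * particleHoleAut ε b := by
  rw [map_mul, particleHoleAut_conjTranspose]

/-- **`P_ε² = w(univ) · 𝟙`**: applying the particle–hole matrix twice multiplies every basis vector by the
SAME unimodular constant `w(univ) = ∏_i conj(ε'_i) · jwSign i univ` (`P|s⟩ = w(s)|sᶜ⟩` and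
`w(s) w(sᶜ) = w(univ)`). [cite: Tasaki2020, §9.3.3] -/
theorem particleHole_mul_particleHole (ε : ι → ℂ) :
    particleHole ε * particleHole ε =
      (∏ i ∈ (univ : Finset ι), star (ε i) * jwSign i univ) • (1 : Matrix (Finset ι) (Finset ι) ℂ) := by
  apply matrix_eq_of_mulVec_eq
  intro ψ
  funext t
  rw [← mulVec_mulVec, particleHole_mulVec_apply, particleHole_mulVec_apply, compl_compl, smul_mulVec,
    one_mulVec, Pi.smul_apply, smul_eq_mul, ← mul_assoc, Finset.prod_compl_mul_prod]

/-- **The particle–hole automorphism is an involution**: `α(α b) = b`. [cite: Tasaki2020, §9.3.3] -/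
theorem particleHoleAut_particleHoleAut (ε : ι → ℤˣ) (b : Matrix (Finset ι) (Finset ι) ℂ) :
    particleHoleAut ε (particleHoleAut ε b) = b := by
  set ε' : ι → ℂ := fun i => (((ε i : ℤˣ) : ℤ) : ℂ) with hε'
  set c : ℂ := ∏ i ∈ (univ : Finset ι), star (ε' i) * jwSign i univ with hc
  have hcc : c * star c = 1 := particleHoleWeight_mul_star ε' (norm_signPhase ε) univ
  rw [particleHoleAut_apply, particleHoleAut_apply]
  calc particleHole ε' * (particleHole ε' * b * (particleHole ε')ᴴ) * (particleHole ε')ᴴ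
      = (particleHole ε' * particleHole ε') * b * (particleHole ε' * particleHole ε')ᴴ := by
        rw [conjTranspose_mul]; simp only [Matrix.mul_assoc]
    _ = b := by
        rw [particleHole_mul_particleHole, conjTranspose_smul, conjTranspose_one, Matrix.smul_mul,
          Matrix.one_mul, Matrix.mul_smul, Matrix.mul_one, smul_smul, mul_comm (star c) c, hcc, one_smul]

/-- **`α` commutes with the even–odd automorphism**: `Θ (α b) = α (Θ b)` (both composites send
`c_i ↦ -ε_i c†_i`, `c†_i ↦ -ε_i c_i`). [cite: ArakiMoriya2003, §4.1 Def. 4.2] -/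
theorem parityAut_particleHoleAut (ε : ι → ℤˣ) (b : Matrix (Finset ι) (Finset ι) ℂ) :
    parityAut (particleHoleAut ε b) = particleHoleAut ε (parityAut b) := by
  have h : (parityAut (κ := ι)).comp (particleHoleAut ε) = (particleHoleAut ε).comp parityAut := by
    refine algHom_ext_car (fun i => ?_) (fun i => ?_)
    · rw [AlgHom.comp_apply, AlgHom.comp_apply, particleHoleAut_annihilation, map_smul, parityAut_creation,
        parityAut_annihilation, map_neg, particleHoleAut_annihilation, smul_neg]
    · rw [AlgHom.comp_apply, AlgHom.comp_apply, particleHoleAut_creation, map_smul, parityAut_annihilation,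
        parityAut_creation, map_neg, particleHoleAut_creation, smul_neg]
  have := congrArg (fun f : Matrix (Finset ι) (Finset ι) ℂ →ₐ[ℂ] Matrix (Finset ι) (Finset ι) ℂ => f b) h
  simpa only [AlgHom.comp_apply] using this

/-- **Flipping all signs composes with `Θ`**: `α_{-ε} = Θ ∘ α_ε`. [cite: ArakiMoriya2003, §4.1 Def. 4.2] -/
theorem particleHoleAut_neg (ε : ι → ℤˣ) (b : Matrix (Finset ι) (Finset ι) ℂ) :
    particleHoleAut (-ε) b = parityAut (particleHoleAut ε b) := by
  have h : particleHoleAut (-ε) = (parityAut (κ := ι)).comp (particleHoleAut ε) := by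
    refine algHom_ext_car (fun i => ?_) (fun i => ?_)
    · rw [AlgHom.comp_apply, particleHoleAut_annihilation, particleHoleAut_annihilation, map_smul,
        parityAut_creation, Pi.neg_apply, Units.val_neg, Int.cast_neg, neg_smul, smul_neg]
    · rw [AlgHom.comp_apply, particleHoleAut_creation, particleHoleAut_creation, map_smul,
        parityAut_annihilation, Pi.neg_apply, Units.val_neg, Int.cast_neg, neg_smul, smul_neg]
  rw [h, AlgHom.comp_apply]

end Local

section Intertwine

variable {Λ Λ' : Type*} [LinearOrder Λ] [Fintype Λ] [LinearOrder Λ'] [Fintype Λ']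

/-- **The second quantisation of a site injection intertwines the particle–hole automorphisms whose signs
correspond**: if `ε'(φ x, σ) = ε(x, σ)` for every orbital, then `Γ(φ) ∘ α_ε = α_{ε'} ∘ Γ(φ)` (both are the
algebra homomorphisms `c_{xσ} ↦ ε_{xσ} c†_{φ x, σ}`). [cite: BratteliRobinsonII1997, §5.2.2 Thm. 5.2.5] -/
theorem fermionEmbed_comp_particleHoleAut (φ : Λ ↪ Λ') (ε : Orb Λ → ℤˣ) (ε' : Orb Λ' → ℤˣ)
    (h : ∀ i : Orb Λ, ε' (orb (φ (ofLex i).1) (ofLex i).2) = ε i) :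
    (fermionEmbed φ).comp (particleHoleAut ε) = (particleHoleAut ε').comp (fermionEmbed φ) := by
  refine algHom_ext_car (fun i => ?_) (fun i => ?_)
  · rw [AlgHom.comp_apply, AlgHom.comp_apply, particleHoleAut_annihilation, map_smul, fermionEmbed_creation',
      fermionEmbed_annihilation', particleHoleAut_annihilation]
    exact congrArg (fun u : ℤˣ => (((u : ℤˣ) : ℤ) : ℂ) • creation (orb (φ (ofLex i).1) (ofLex i).2)) (h i).symm
  · rw [AlgHom.comp_apply, AlgHom.comp_apply, particleHoleAut_creation, map_smul, fermionEmbed_annihilation',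
      fermionEmbed_creation', particleHoleAut_creation]
    exact congrArg (fun u : ℤˣ => (((u : ℤˣ) : ℤ) : ℂ) • annihilation (orb (φ (ofLex i).1) (ofLex i).2)) (h i).symm

/-- Pointwise form of the intertwining. [cite: BratteliRobinsonII1997, §5.2.2 Thm. 5.2.5] -/
theorem fermionEmbed_particleHoleAut (φ : Λ ↪ Λ') (ε : Orb Λ → ℤˣ) (ε' : Orb Λ' → ℤˣ)
    (h : ∀ i : Orb Λ, ε' (orb (φ (ofLex i).1) (ofLex i).2) = ε i) (a : Matrix (Finset (Orb Λ)) (Finset (Orb Λ)) ℂ) :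
    fermionEmbed φ (particleHoleAut ε a) = particleHoleAut ε' (fermionEmbed φ a) := by
  have := congrArg (fun f : Matrix (Finset (Orb Λ)) (Finset (Orb Λ)) ℂ →ₐ[ℂ]
      Matrix (Finset (Orb Λ')) (Finset (Orb Λ')) ℂ => f a) (fermionEmbed_comp_particleHoleAut φ ε ε' h)
  simpa only [AlgHom.comp_apply] using this

end Intertwine

/-! ### §2 Regions of `ℤ^d`: the staggered particle–hole automorphisms of the local algebras -/

section Regions

variable {d : ℕ}

/-- **The staggering sign of `ℤ^d`**: `ε_x = (-1)^{x₁ + ⋯ + x_d}` (`ℤ^d` is bipartite; `ε` is `-1` on one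
sublattice). [cite: LiebPRL1989, proof of Theorem 2] -/
def siteStagger (x : Site d) : ℤˣ := (∑ i, x i).negOnePow

/-- The stagger is multiplicative under translations: `ε_{x+v} = ε_x ε_v`. [cite: LiebPRL1989, proof of Theorem 2] -/
theorem siteStagger_add (x v : Site d) : siteStagger (x + v) = siteStagger x * siteStagger v := by
  unfold siteStagger
  rw [← Int.negOnePow_add]
  congr 1
  rw [← Finset.sum_add_distrib]
  rfl

/-- `ε_0 = 1`. [cite: LiebPRL1989, proof of Theorem 2] -/
@[simp] theorem siteStagger_zero : siteStagger (0 : Site d) = 1 := by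
  unfold siteStagger
  simp [Int.negOnePow_zero]

/-- `ε_{-x} = ε_x`. [cite: LiebPRL1989, proof of Theorem 2] -/
theorem siteStagger_neg (x : Site d) : siteStagger (-x) = siteStagger x := by
  unfold siteStagger
  rw [show (∑ i, (-x) i) = -∑ i, x i by simp [Finset.sum_neg_distrib], Int.negOnePow_neg]

/-- A unit step flips the stagger: `ε_{e_k} = -1`, hence `ε_{x + e_k} = -ε_x` (nearest neighbours of `ℤ^d`
carry opposite signs). [cite: LiebPRL1989, proof of Theorem 2] -/
theorem siteStagger_single_one (k : Fin d) : siteStagger (Pi.single k (1 : ℤ) : Site d) = -1 := by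
  unfold siteStagger
  rw [Finset.sum_pi_single']
  simp [Int.negOnePow_one]

/-- `ε_{x + e_k} = -ε_x`. [cite: LiebPRL1989, proof of Theorem 2] -/
theorem siteStagger_add_single_one (x : Site d) (k : Fin d) :
    siteStagger (x + Pi.single k (1 : ℤ)) = -siteStagger x := by
  rw [siteStagger_add, siteStagger_single_one, mul_neg, mul_one]

/-- A stagger is `1` or `-1`. [cite: LiebPRL1989, proof of Theorem 2] -/
theorem siteStagger_eq_one_or (x : Site d) : siteStagger x = 1 ∨ siteStagger x = -1 :=
  Int.units_eq_one_or _

/-- **The particle–hole signs of a region**: the orbital `(x, σ)`, `x ∈ Λ`, carries `ε_x` (both spins alike —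
Lieb's FULL particle–hole transformation, not the partial one). [cite: LiebPRL1989, proof of Theorem 2] -/
def phSign (Λ : Finset (Site d)) : Orb (PolySite Λ) → ℤˣ :=
  fun i => siteStagger (ofLex ((ofLex i).1 : PolySite Λ).1)

/-- The sign of the orbital `(x, σ)` is `ε_x`. [cite: LiebPRL1989, proof of Theorem 2] -/
@[simp] theorem phSign_orb_pt {Λ : Finset (Site d)} (x : Site d) (hx : x ∈ Λ) (σ : Fin 2) :
    phSign Λ (orb (PolySite.pt x hx) σ) = siteStagger x := rfl

/-- The sign of the orbital `(y, σ)`, `y` an ordered site. [cite: LiebPRL1989, proof of Theorem 2] -/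
theorem phSign_orb {Λ : Finset (Site d)} (y : PolySite Λ) (σ : Fin 2) :
    phSign Λ (orb y σ) = siteStagger (ofLex y.1) := rfl

/-- **The staggered particle–hole automorphism `α_Λ` of the local algebra `𝔄_Λ`** of a finite region
`Λ ⊆ ℤ^d`: `α_Λ(A) = P_Λ A P_Λᴴ`, `α_Λ(c_{xσ}) = ε_x c†_{xσ}`. [cite: Tasaki2020, §9.3.3] -/
def phAut (Λ : Finset (Site d)) : FermionOp Λ →ₐ[ℂ] FermionOp Λ := particleHoleAut (phSign Λ)

/-- `α_Λ(c_{xσ}) = ε_x c†_{xσ}`. [cite: Tasaki2020, §9.3.3] -/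
theorem phAut_cAt {Λ : Finset (Site d)} (x : Site d) (hx : x ∈ Λ) (σ : Fin 2) :
    phAut Λ (cAt x hx σ) = (((siteStagger x : ℤˣ) : ℤ) : ℂ) • (cAt x hx σ)ᴴ := by
  rw [phAut, cAt, particleHoleAut_annihilation, phSign_orb_pt, annihilation_conjTranspose]

/-- `α_Λ(c†_{xσ}) = ε_x c_{xσ}`. [cite: Tasaki2020, §9.3.3] -/
theorem phAut_cAt_conjTranspose {Λ : Finset (Site d)} (x : Site d) (hx : x ∈ Λ) (σ : Fin 2) :
    phAut Λ (cAt x hx σ)ᴴ = (((siteStagger x : ℤˣ) : ℤ) : ℂ) • cAt x hx σ := by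
  rw [phAut, cAt, annihilation_conjTranspose, particleHoleAut_creation, phSign_orb_pt]

/-- `α_Λ(n_{xσ}) = 1 - n_{xσ}`. [cite: EsslerEtAl2005, §2.2.4 eqs. (2.59)–(2.61)] -/
theorem phAut_nAt {Λ : Finset (Site d)} (x : Site d) (hx : x ∈ Λ) (σ : Fin 2) :
    phAut Λ (nAt x hx σ) = 1 - nAt x hx σ :=
  particleHoleAut_numberAt (phSign Λ) (orb (PolySite.pt x hx) σ)

/-- `α_Λ` is an involution. [cite: Tasaki2020, §9.3.3] -/
theorem phAut_phAut {Λ : Finset (Site d)} (A : FermionOp Λ) : phAut Λ (phAut Λ A) = A :=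
  particleHoleAut_particleHoleAut _ A

/-- `α_Λ` is a `*`-map. [cite: BratteliRobinsonII1997, §5.2.2 Thm. 5.2.5] -/
theorem phAut_conjTranspose {Λ : Finset (Site d)} (A : FermionOp Λ) : phAut Λ Aᴴ = (phAut Λ A)ᴴ :=
  particleHoleAut_conjTranspose _ A

/-- `α_Λ` commutes with `Θ`. [cite: ArakiMoriya2003, §4.1 Def. 4.2] -/
theorem parityAut_phAut {Λ : Finset (Site d)} (A : FermionOp Λ) :
    parityAut (phAut Λ A) = phAut Λ (parityAut A) :=
  parityAut_particleHoleAut _ A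

/-- **Compatibility with isotony**: `Γ(Λ ⊆ Λ') (α_Λ A) = α_{Λ'} (Γ(Λ ⊆ Λ') A)` (the same site carries the same
sign in both regions). [cite: BratteliRobinsonII1997, §5.2.2 Thm. 5.2.5] -/
theorem fermionEmbed_incl_phAut {Λ Λ' : Finset (Site d)} (h : Λ ⊆ Λ') (A : FermionOp Λ) :
    fermionEmbed (PolySite.incl h) (phAut Λ A) = phAut Λ' (fermionEmbed (PolySite.incl h) A) :=
  fermionEmbed_particleHoleAut (PolySite.incl h) (phSign Λ) (phSign Λ') (fun _ => rfl) A

/-- **Translation covariance, even translations**: for `ε_v = 1`,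
`Γ(τ_v) (α_Λ A) = α_{Λ+v} (Γ(τ_v) A)`. [cite: ArakiMoriya2003, §4.1 Def. 4.3] -/
theorem fermionEmbed_shiftEmb_phAut_of_eq_one {Λ : Finset (Site d)} {v : Site d} (hv : siteStagger v = 1)
    (A : FermionOp Λ) :
    fermionEmbed (PolySite.shiftEmb v Λ) (phAut Λ A) =
      phAut (shiftSet v Λ) (fermionEmbed (PolySite.shiftEmb v Λ) A) := by
  refine fermionEmbed_particleHoleAut (PolySite.shiftEmb v Λ) (phSign Λ) (phSign (shiftSet v Λ)) (fun i => ?_) A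
  rw [phSign_orb, PolySite.ofLex_coe_shiftEmb, siteStagger_add, hv, mul_one]
  rfl

/-- **Translation covariance, odd translations**: for `ε_v = -1`,
`Γ(τ_v) (α_Λ A) = α_{Λ+v} (Θ (Γ(τ_v) A))` (the signs of `Λ + v` are the negatives of the translated signs
of `Λ`; `α_{-ε} = Θ ∘ α_ε`). [cite: ArakiMoriya2003, §4.1 Def. 4.3] -/
theorem fermionEmbed_shiftEmb_phAut_of_eq_neg_one {Λ : Finset (Site d)} {v : Site d}
    (hv : siteStagger v = -1) (A : FermionOp Λ) :
    fermionEmbed (PolySite.shiftEmb v Λ) (phAut Λ A) =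
      phAut (shiftSet v Λ) (parityAut (fermionEmbed (PolySite.shiftEmb v Λ) A)) := by
  have h1 : fermionEmbed (PolySite.shiftEmb v Λ) (phAut Λ A) =
      particleHoleAut (-phSign (shiftSet v Λ)) (fermionEmbed (PolySite.shiftEmb v Λ) A) := by
    refine fermionEmbed_particleHoleAut (PolySite.shiftEmb v Λ) (phSign Λ) (-phSign (shiftSet v Λ))
      (fun i => ?_) A
    rw [Pi.neg_apply, phSign_orb, PolySite.ofLex_coe_shiftEmb, siteStagger_add, hv, mul_neg, mul_one, neg_neg]
    rfl
  rw [h1, particleHoleAut_neg, parityAut_particleHoleAut]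
  rfl

end Regions

/-! ### §3 The particle–hole transformed state `ω ∘ α` -/

namespace InfVolFermionState

variable {d : ℕ} (ω : InfVolFermionState d)

/-- **The particle–hole transform `ω ∘ α` of an infinite-volume fermion state**: `(ω ∘ α)_Λ(A) = ω_Λ(α_Λ A)`
on every local algebra (a state: the `α_Λ` are unital `*`-automorphisms compatible with isotony).
[cite: Tasaki2020, §9.3.3] [cite: BratteliRobinsonII1997, §5.2.2 Thm. 5.2.5] -/
def particleHole (ω : InfVolFermionState d) : InfVolFermionState d where
  expect Λ := ω.expect Λ ∘ₗ (phAut Λ).toLinearMap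
  expect_one Λ := by
    rw [LinearMap.comp_apply, AlgHom.toLinearMap_apply, map_one, ω.expect_one]
  expect_nonneg Λ A := by
    rw [LinearMap.comp_apply, AlgHom.toLinearMap_apply, phAut, particleHoleAut_conjTranspose_mul_self]
    exact ω.expect_nonneg _ _
  compatible Λ Λ' h A := by
    rw [LinearMap.comp_apply, AlgHom.toLinearMap_apply, LinearMap.comp_apply, AlgHom.toLinearMap_apply,
      ← fermionEmbed_incl_phAut, ω.compatible h]

/-- The local expectations of the transformed state (definitional unfolding). [cite: Tasaki2020, §9.3.3] -/
theorem particleHole_expect (Λ : Finset (Site d)) (A : FermionOp Λ) :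
    ω.particleHole.expect Λ A = ω.expect Λ (phAut Λ A) := rfl

/-- **The particle–hole transformation of states is an involution.** [cite: Tasaki2020, §9.3.3] -/
theorem particleHole_particleHole : ω.particleHole.particleHole = ω := by
  refine InfVolFermionState.ext fun Λ => LinearMap.ext fun A => ?_
  rw [particleHole_expect, particleHole_expect, phAut_phAut]

/-- It is injective (an involution). [cite: Tasaki2020, §9.3.3] -/
theorem particleHole_injective : Function.Injective (particleHole (d := d)) := fun ω₁ ω₂ h => by
  rw [← particleHole_particleHole ω₁, h, particleHole_particleHole]

/-- **Evenness is preserved**: `α_Λ` commutes with `Θ`. [cite: ArakiMoriya2003, §4.1 Def. 4.5] -/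
theorem IsEven.particleHole {ω : InfVolFermionState d} (h : ω.IsEven) : ω.particleHole.IsEven := fun Λ A => by
  rw [particleHole_expect, particleHole_expect, ← parityAut_phAut, h]

/-- **Translations and the particle–hole transform commute on EVEN states**:
`(ω ∘ τ_v) ∘ α = (ω ∘ α) ∘ τ_v` (for odd `v` the two sides differ by `Θ`, invisible in an even state).
[cite: ArakiMoriya2003, §4.1 Def. 4.3 and Def. 4.5] -/
theorem IsEven.particleHole_shift {ω : InfVolFermionState d} (h : ω.IsEven) (v : Site d) :
    (ω.shift v).particleHole = ω.particleHole.shift v := by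
  refine InfVolFermionState.ext fun Λ => LinearMap.ext fun A => ?_
  rw [particleHole_expect, shift_expect, shift_expect, particleHole_expect]
  rcases siteStagger_eq_one_or v with hv | hv
  · rw [fermionEmbed_shiftEmb_phAut_of_eq_one hv]
  · rw [fermionEmbed_shiftEmb_phAut_of_eq_neg_one hv, ← parityAut_phAut, h]

/-- **A translation-invariant even state has a translation-invariant particle–hole transform.**
[cite: ArakiMoriya2003, §4.1 Def. 4.5] -/
theorem IsTranslationInvariant.particleHole {ω : InfVolFermionState d} (h : ω.IsTranslationInvariant)
    (he : ω.IsEven) : ω.particleHole.IsTranslationInvariant := fun v => by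
  rw [← he.particleHole_shift v, h v]

/-- Mixtures commute with the transform (it is affine). [cite: BratteliRobinsonI1987, §4.3.1] -/
theorem particleHole_mix (t : ℝ) (ht₀ : 0 ≤ t) (ht₁ : t ≤ 1) (ω₁ ω₂ : InfVolFermionState d) :
    (mix t ht₀ ht₁ ω₁ ω₂).particleHole = mix t ht₀ ht₁ ω₁.particleHole ω₂.particleHole := by
  refine InfVolFermionState.ext fun Λ => LinearMap.ext fun A => ?_
  rw [particleHole_expect, mix_expect, mix_expect, particleHole_expect, particleHole_expect]

/-- **Occupation numbers become hole numbers**: `(ω ∘ α)(n_{xσ}) = 1 - ω(n_{xσ})`.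
[cite: EsslerEtAl2005, §2.2.4 eqs. (2.59)–(2.61)] -/
theorem particleHole_expect_nAt {Λ : Finset (Site d)} (x : Site d) (hx : x ∈ Λ) (σ : Fin 2) :
    ω.particleHole.expect Λ (nAt x hx σ) = 1 - ω.expect Λ (nAt x hx σ) := by
  rw [particleHole_expect, phAut_nAt, map_sub, ω.expect_one]

/-- **Electron doping is hole doping**: the particle density of the transformed state at any site is
`2 - ρ(x)`. [cite: EsslerEtAl2005, §2.2.4 eqs. (2.59)–(2.61)] -/
theorem densityAt_particleHole (x : Site d) : ω.particleHole.densityAt x = 2 - ω.densityAt x := by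
  rw [densityAt, densityAt, map_add, map_add, particleHole_expect_nAt, particleHole_expect_nAt, Complex.add_re,
    Complex.add_re, Complex.sub_re, Complex.sub_re, Complex.one_re]
  ring

/-- The density of the transformed (translation-invariant) state: `ρ(ω ∘ α) = 2 - ρ(ω)`.
[cite: EsslerEtAl2005, §2.2.4 eqs. (2.59)–(2.61)] -/
theorem density_particleHole : ω.particleHole.density = 2 - ω.density :=
  densityAt_particleHole ω 0

/-- Pairs of occupation numbers: `(ω ∘ α)(n_{x↑} n_{x↓}) = 1 - ω(n_{x↑}) - ω(n_{x↓}) + ω(n_{x↑} n_{x↓})` — the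
double occupancy of the transform is the double VACANCY of `ω`. [cite: EsslerEtAl2005, §2.2.4 eqs. (2.59)–(2.61)] -/
theorem particleHole_expect_nAt_mul_nAt {Λ : Finset (Site d)} (x : Site d) (hx : x ∈ Λ) :
    ω.particleHole.expect Λ (nAt x hx 0 * nAt x hx 1) =
      1 - ω.expect Λ (nAt x hx 0) - ω.expect Λ (nAt x hx 1) + ω.expect Λ (nAt x hx 0 * nAt x hx 1) := by
  rw [particleHole_expect, map_mul, phAut_nAt, phAut_nAt, sub_mul, mul_sub, mul_sub, Matrix.one_mul,
    Matrix.mul_one, Matrix.one_mul, map_sub, map_sub, map_sub, ω.expect_one]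
  ring

end InfVolFermionState

end Literature.MathematicalPhysics.QuantumLattice
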